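import Literature.Probability.RandomPlanarGeometry.HexSAWBridgeDecay
import Literature.Probability.RandomPlanarGeometry.HexSAWEscapeMass
import HarnessLib

/-!
# The infinite-strip identity `cos(3π/8) A_T + B_T = 1` at `x_c` (i.e. `E_T = 0`), unconditionally

Topic `Literature/Probability/RandomPlanarGeometry`. Sources:
* A. Glazman, I. Manolescu, *Self-avoiding walk on `ℤ²` with Yang–Baxter weights: universality of
  critical fugacity and 2-point function*, Ann. Inst. Henri Poincaré Probab. Stat. 56 (2020),
  arXiv:1708.00395, **Corollary 2.3**: "`cos(3π/8) A_T + B_T = 1`" for the infinite strip of `T` rows of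
  hexagons at `x = x_c` — equivalently, Duminil-Copin–Smirnov's `E_T^{x_c} = 0` for every `T`;
* H. Duminil-Copin, S. Smirnov, *The connective constant of the honeycomb lattice equals `√(2+√2)`*,
  Ann. of Math. 175 (2012), 1653–1665, arXiv:1007.0575, §3, eqs. (4)–(6) and "it follows easily by
  induction that `B_T^{x_c} ≥ min[B_1^{x_c}, 1/(c_α x_c⁻¹)]/T` for every `T ≥ 1`";
* D. Krachun, C. Panagiotis, *Quantitative sub-ballisticity of self-avoiding walk on the hexagonal
  lattice*, Ann. Probab. 54 (2026), arXiv:2310.17299, **Lemma 2.3**: "The sequences `(B_k)_{k ≥ 0}` and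
  `(D_k)_{k ≥ 0}` are non-increasing and `B_k ≤ cos(π/8) D_k` for every `k ≥ 0`", and §1: "The lower
  bound `B_T ≥ c/T` was obtained in [DCS12] using the parafermionic observable".

In `HexSAWLowerBound.lean` the vanishing `E_T = 0` (`stripElim_eq_zero`) — and with it eq. (5) of [DCS12],
the monotonicity of `B_T` in `T` and the harmonic lower bound `B_T ≥ m/T` (`stripBlim_ge`) — are only
available under the hypothesis `Σₙ cₙ x_cⁿ < ∞`, which that very file refutes (`not_summable_of_lemma2`).
Here they are proved UNCONDITIONALLY (with Lemma 2 discharged, `DuminilCopinSmirnov2012_lemma2_holds`), by a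
monotonicity argument that only uses the existing API of the tree:

1. `E_{T,L} ≤ E_{T+1,L}` for every finite trapezoid (`S_{T,L} ⊆ S_{T+1,L}` and the class `ε ∪ ε̄` of exit
   half-edges through the oblique cuts does not depend on `T`), hence `E_T ≤ E_{T+1}` after `L → ∞`
   (`HV.stripE_mono_T`, `stripElim_mono`);
2. `0 ≤ E_T = (1 − c_α A_T − B_T)/c_ε ≤ (1 − c_α A^Δ_{2L+1})/c_ε = 2 cos(π/8) · triDl L / c_ε → 0`
   (`T ≥ 2L+1`), by Glazman–Manolescu's triangle identity (Lemma 4.1, `HV.tri_identity'`) and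
   Proposition 1.1 (`HV.tendsto_triDl`) (`stripElim_le_triDl`, `tendsto_stripElim`);
3. a non-decreasing nonnegative sequence tending to `0` vanishes identically: **`stripElim_zero`**,
   i.e. **`strip_identity_lim`**: `cos(3π/8) A_T + B_T = 1` (Glazman–Manolescu, Corollary 2.3; this settles
   Duminil-Copin–Smirnov's dichotomy "`E_T > 0` for some `T`" / "`E_T = 0` for all `T`" in favour of the
   second alternative, with no appeal to `Z(x_c)`).

Consequences recorded here: `B_T = 1 − c_α A_T` (`stripBlim_eq_escape`) is non-increasing in `T ≥ 1`
(`stripBlim_succ_le`, `stripBlim_antitone'`; Krachun–Panagiotis, Lemma 2.3); the UNCONDITIONAL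
Duminil-Copin–Smirnov lower bound **`stripBlim_ge_div`**: `B_{T+1} ≥ min(B_1, x_c/c_α)/(T+1)` (from the
escape-mass form `escape_ge` of `HexSAWEscapeMass.lean`); `B_{2L+1} ≤ 2 cos(π/8) · triDl L`
(`stripBlim_le_two_mul_triDl`, Lemma 2.3 / Glazman–Manolescu (4.1) in the limit `L' → ∞`); the
triangle-tail lower bound **`triDl_ge_div`**: `triDl L ≥ m/(L+1)` for some `m > 0`; and `A_T → 1/c_α`
(`tendsto_stripAlim`, from `B_T → 0`).
-/

noncomputable section

open Filter Topology

namespace Literature.Probability.RandomPlanarGeometry.SAW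

open HV

namespace HV

/-- `A_{T,L}(x) ≤ A_{T+1,L}(x)` (`x ≥ 0`): `S_{T,L} ⊆ S_{T+1,L}` and the class `α` of final half-edges
does not depend on `T` ("all walks contributing to `A_k` contribute also to `A_{k+1}`").
[cite: KrachunPanagiotis2026, Lemma 2.3 (proof)] -/
theorem stripA_mono_T {T L : ℕ} {x : ℝ} (hx : 0 ≤ x) : stripA T L x ≤ stripA (T + 1) L x :=
  Finset.sum_le_sum_of_subset_of_nonneg
    (Finset.filter_subset_filter _ (midWalks_mono (stripV_mono_T (Nat.le_succ T))))
    fun _ _ _ => pow_nonneg hx _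

/-- `E_{T,L}(x) ≤ E_{T+1,L}(x)` (`x ≥ 0`): `S_{T,L} ⊆ S_{T+1,L}` and the class `ε ∪ ε̄` of final
half-edges (those crossing one of the two oblique cuts at distance `L` from `a`) does not depend on `T`,
so every walk of `S_{T,L}` from `a` to `ε ∪ ε̄` is a walk of `S_{T+1,L}` from `a` to `ε ∪ ε̄`.
[cite: DuminilCopinSmirnov2012, §3 (S_{T,L}, E_{T,L})] -/
theorem stripE_mono_T {T L : ℕ} {x : ℝ} (hx : 0 ≤ x) : stripE T L x ≤ stripE (T + 1) L x :=
  Finset.sum_le_sum_of_subset_of_nonneg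
    (Finset.filter_subset_filter _ (midWalks_mono (stripV_mono_T (Nat.le_succ T))))
    fun _ _ _ => pow_nonneg hx _

end HV

/-! ### Monotonicity in `T` of the limits `A_T`, `E_T` -/

/-- `A_T ≤ A_{T+1}` for `T ≥ 1` ("`A_{k+1} ≥ A_k`", pass to `sup_L`).
[cite: KrachunPanagiotis2026, Lemma 2.3 (proof)] -/
theorem stripAlim_mono {T : ℕ} (hT : 1 ≤ T) : stripAlim T ≤ stripAlim (T + 1) :=
  ciSup_le fun L => (stripA_mono_T hexCriticalFugacity_pos_lt_one.1.le).trans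
    (stripA_le_lim DuminilCopinSmirnov2012_lemma2_holds (by omega) L)

/-- `E_T ≤ E_{T+1}` for `T ≥ 1`: pass to the limit `L → ∞` in `E_{T,L} ≤ E_{T+1,L}`.
[cite: DuminilCopinSmirnov2012, §3 (E_T = lim_L E_{T,L})] -/
theorem stripElim_mono {T : ℕ} (hT : 1 ≤ T) : stripElim T ≤ stripElim (T + 1) :=
  le_of_tendsto_of_tendsto' (tendsto_stripE DuminilCopinSmirnov2012_lemma2_holds hT)
    (tendsto_stripE DuminilCopinSmirnov2012_lemma2_holds (by omega))
    fun _ => stripE_mono_T hexCriticalFugacity_pos_lt_one.1.le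

/-- `E_T ≤ E_{T'}` for `1 ≤ T ≤ T'`. [cite: DuminilCopinSmirnov2012, §3 (E_T)] -/
theorem stripElim_mono' {T T' : ℕ} (hT : 1 ≤ T) (h : T ≤ T') : stripElim T ≤ stripElim T' := by
  induction T', h using Nat.le_induction with
  | base => exact le_rfl
  | succ n hn ih => exact ih.trans (stripElim_mono (hT.trans hn))

/-! ### Comparison with the triangle `T_L ⊆ S_{2L+1}` and `E_T → 0` -/

/-- `A^Δ_{2L+1} ≤ A_T` for `T ≥ 2L+1` ("`A^Δ_{2L+1} ≤ A_{2L+1}` since the latter partition function is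
over a larger set of walks", and `A_{2L+1} ≤ A_T`). [cite: GlazmanManolescu2019, Lemma 4.1 (proof)] -/
theorem triA_le_stripAlim {L T : ℕ} (h : 2 * L + 1 ≤ T) : triA L ≤ stripAlim T :=
  (triA_le_stripA h le_rfl).trans (stripA_le_lim DuminilCopinSmirnov2012_lemma2_holds (by omega) L)

/-- `E_T ≤ (2 cos(π/8)/cos(π/4)) · triDl L` for `T ≥ 2L+1`: `c_ε E_T = 1 − c_α A_T − B_T ≤ 1 − c_α A^Δ_{2L+1}
= cos(π/8) D^Δ_{2L+1} = 2 cos(π/8) · triDl L` (Lemma 4.1 and the symmetry of the triangle).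
[cite: GlazmanManolescu2019, Lemma 4.1] -/
theorem stripElim_le_triDl {L T : ℕ} (h : 2 * L + 1 ≤ T) :
    stripElim T ≤ 2 * Real.cos (Real.pi / 8) / Real.cos (Real.pi / 4) * triDl L := by
  have hA := triA_le_stripAlim h
  have hB := stripBlim_nonneg (T := T) (by omega)
  have hid := tri_identity' L
  have hc := cos_three_pi_div_eight_pos
  have hc' := cos_pi_div_four_pos'
  have hcA := mul_le_mul_of_nonneg_left hA hc.le
  rw [stripElim, div_mul_eq_mul_div]
  apply div_le_div_of_nonneg_right _ hc'.le
  linarith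

/-- **`E_T → 0` as `T → ∞`** (`0 ≤ E_T ≤ (2 cos(π/8)/c_ε) · triDl L` for `T ≥ 2L+1`, and `triDl L → 0`,
Glazman–Manolescu's Proposition 1.1 for the triangle). [cite: GlazmanManolescu2019, Proposition 1.1 and Lemma 4.1] -/
theorem tendsto_stripElim : Tendsto stripElim atTop (𝓝 0) := by
  rw [Metric.tendsto_atTop]
  intro ε hε
  set κ := 2 * Real.cos (Real.pi / 8) / Real.cos (Real.pi / 4) with hκ
  have hκ0 : 0 < κ := div_pos (mul_pos two_pos cos_pi_div_eight_pos) cos_pi_div_four_pos'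
  obtain ⟨L₀, hL₀⟩ := (Metric.tendsto_atTop.1 tendsto_triDl) (ε / κ) (div_pos hε hκ0)
  refine ⟨2 * L₀ + 1, fun T hT => ?_⟩
  have h0 : 0 ≤ stripElim T := stripElim_nonneg DuminilCopinSmirnov2012_lemma2_holds (by omega)
  have h1 : stripElim T ≤ κ * triDl L₀ := stripElim_le_triDl hT
  have h2 := hL₀ L₀ le_rfl
  rw [Real.dist_eq, sub_zero, abs_of_nonneg (triDl_nonneg L₀)] at h2
  rw [Real.dist_eq, sub_zero, abs_of_nonneg h0]
  calc stripElim T ≤ κ * triDl L₀ := h1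
    _ < κ * (ε / κ) := mul_lt_mul_of_pos_left h2 hκ0
    _ = ε := mul_div_cancel₀ ε hκ0.ne'

/-! ### `E_T = 0`: the infinite-strip identity -/

/-- **`E_T^{x_c} = 0` for every `T ≥ 1`** (Glazman–Manolescu, Corollary 2.3, in Duminil-Copin–Smirnov's
notation): the sequence `(E_T)_{T ≥ 1}` is non-decreasing, nonnegative and tends to `0`, hence vanishes
identically. This resolves DCS's dichotomy "`E_T > 0` for some `T`" / "`E_T = 0` for all `T`" (§3, proof
of Theorem 1) unconditionally. [cite: GlazmanManolescu2019, Corollary 2.3] -/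
theorem stripElim_zero {T : ℕ} (hT : 1 ≤ T) : stripElim T = 0 :=
  le_antisymm
    (ge_of_tendsto tendsto_stripElim ((eventually_ge_atTop T).mono fun _ h => stripElim_mono' hT h))
    (stripElim_nonneg DuminilCopinSmirnov2012_lemma2_holds hT)

/-- **Glazman–Manolescu, Corollary 2.3 — the infinite-strip identity `cos(3π/8) A_T + B_T = 1`** at
`x = x_c`, for every `T ≥ 1` (Duminil-Copin–Smirnov's eq. (5), now unconditional).
[cite: GlazmanManolescu2019, Corollary 2.3] -/
theorem strip_identity_lim {T : ℕ} (hT : 1 ≤ T) :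
    Real.cos (3 * Real.pi / 8) * stripAlim T + stripBlim T = 1 := by
  have h := lemma2_lim T
  rw [stripElim_zero hT, mul_zero, add_zero] at h
  exact h.symm

/-- `B_T = 1 − c_α A_T` (`T ≥ 1`): the bridge mass equals the escape mass.
[cite: GlazmanManolescu2019, Corollary 2.3] -/
theorem stripBlim_eq_escape {T : ℕ} (hT : 1 ≤ T) :
    stripBlim T = 1 - Real.cos (3 * Real.pi / 8) * stripAlim T := by
  have h := strip_identity_lim hT
  linarith

/-! ### `B_T` is non-increasing -/

/-- **`B_{T+1} ≤ B_T`** (`T ≥ 1`): "`B_k − B_{k+1} = cos(3π/8)(A_{k+1} − A_k)` … `A_{k+1} ≥ A_k`, which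
implies that `B_{k+1} ≤ B_k`". [cite: KrachunPanagiotis2026, Lemma 2.3] -/
theorem stripBlim_succ_le {T : ℕ} (hT : 1 ≤ T) : stripBlim (T + 1) ≤ stripBlim T := by
  rw [stripBlim_eq_escape hT, stripBlim_eq_escape (T := T + 1) (by omega)]
  have h := mul_le_mul_of_nonneg_left (stripAlim_mono hT) cos_three_pi_div_eight_pos.le
  linarith

/-- **"The sequence `(B_k)` is non-increasing"**: `B_{T'} ≤ B_T` for `1 ≤ T ≤ T'`.
[cite: KrachunPanagiotis2026, Lemma 2.3] -/
theorem stripBlim_antitone' {T T' : ℕ} (hT : 1 ≤ T) (h : T ≤ T') : stripBlim T' ≤ stripBlim T := by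
  induction T', h using Nat.le_induction with
  | base => exact le_rfl
  | succ n hn ih => exact (stripBlim_succ_le (hT.trans hn)).trans ih

/-! ### The unconditional harmonic lower bound `B_T ≥ m/T` -/

/-- The constant `m = min(B_1, x_c/c_α)` of the lower bound is positive (`B_1 ≥ x_c² > 0`).
[cite: DuminilCopinSmirnov2012, §3 ("B_1 > 0")] -/
theorem stripBlim_ge_div_pos :
    0 < min (stripBlim 1) (Real.cos (3 * Real.pi / 8) * hexCriticalFugacity⁻¹)⁻¹ :=
  lt_min (stripBlim_one_pos DuminilCopinSmirnov2012_lemma2_holds)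
    (inv_pos.2 (mul_pos cos_three_pi_div_eight_pos (inv_pos.2 hexCriticalFugacity_pos_lt_one.1)))

/-- **Duminil-Copin–Smirnov's lower bound, unconditionally: `B_{T+1} ≥ min(B_1, 1/(c_α x_c⁻¹))/(T+1)`**
for every `T` ("it follows easily by induction"; here from the escape-mass induction `escape_ge` and
`B_T = 1 − c_α A_T`). [cite: DuminilCopinSmirnov2012, §3 (proof of Theorem 1, "B_T ≥ min[B_1, 1/(c_α x_c⁻¹)]/T")] -/
theorem stripBlim_ge_div (T : ℕ) :
    min (stripBlim 1) (Real.cos (3 * Real.pi / 8) * hexCriticalFugacity⁻¹)⁻¹ / (T + 1) ≤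
      stripBlim (T + 1) := by
  rw [stripBlim_eq_escape (T := 1) le_rfl, stripBlim_eq_escape (T := T + 1) (by omega)]
  exact escape_ge T

/-! ### Transfer to the triangle: `triDl L ≥ m/(L+1)` -/

/-- **`B_{2L+1} ≤ cos(π/8) D^Δ_{2L+1} = 2 cos(π/8) · triDl L`** (Glazman–Manolescu (4.1) /
Krachun–Panagiotis Lemma 2.3, from the finite-volume `stripB_le_triDl` by `sup_{L'}`).
[cite: KrachunPanagiotis2026, Lemma 2.3] -/
theorem stripBlim_le_two_mul_triDl (L : ℕ) :
    stripBlim (2 * L + 1) ≤ 2 * Real.cos (Real.pi / 8) * triDl L :=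
  ciSup_le fun L' => stripB_le_triDl le_rfl L'

/-- **Triangle-tail lower bound: `triDl L ≥ m/(L+1)` for some `m > 0` and all `L`** — the walks of the
triangle `T_L` from `a` to its left side carry `x_c`-mass at least `c/L`: combine `B_{2L+1} ≥ m₀/(2L+1)`
("the lower bound `B_T ≥ c/T`") with `B_{2L+1} ≤ 2 cos(π/8) · triDl L` (Lemma 2.3); `m = m₀/(4 cos(π/8))`.
[cite: KrachunPanagiotis2026, §1 ("the lower bound B_T ≥ c/T") and Lemma 2.3] -/
theorem triDl_ge_div : ∃ m : ℝ, 0 < m ∧ ∀ L : ℕ, m / ((L : ℝ) + 1) ≤ triDl L := by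
  set m₀ := min (stripBlim 1) (Real.cos (3 * Real.pi / 8) * hexCriticalFugacity⁻¹)⁻¹ with hm₀
  have hm₀pos : 0 < m₀ := stripBlim_ge_div_pos
  have hc := cos_pi_div_eight_pos
  refine ⟨m₀ / (4 * Real.cos (Real.pi / 8)), by positivity, fun L => ?_⟩
  have h1 := stripBlim_ge_div (2 * L)
  have h2 := stripBlim_le_two_mul_triDl L
  have hD := triDl_nonneg L
  have hcD := mul_nonneg hc.le hD
  push_cast at h1
  have hL : (0 : ℝ) < 2 * L + 1 := by positivity
  have h3 : m₀ / (2 * L + 1) ≤ 2 * Real.cos (Real.pi / 8) * triDl L := h1.trans h2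
  rw [div_le_iff₀ hL] at h3
  rw [div_le_iff₀ (by positivity), div_le_iff₀ (by positivity)]
  linarith

/-! ### `A_T → 1/c_α` -/

/-- `A_T → 1/cos(3π/8)` as `T → ∞` (from `cos(3π/8) A_T + B_T = 1` and `B_T → 0`, Proposition 1.1).
[cite: GlazmanManolescu2019, Corollary 2.3 and Proposition 1.1] -/
theorem tendsto_stripAlim : Tendsto stripAlim atTop (𝓝 (Real.cos (3 * Real.pi / 8))⁻¹) := by
  have hc := cos_three_pi_div_eight_pos
  have h1 : Tendsto (fun T => (1 - stripBlim T) / Real.cos (3 * Real.pi / 8)) atTop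
      (𝓝 ((1 - 0) / Real.cos (3 * Real.pi / 8))) :=
    (tendsto_stripBlim.const_sub 1).div_const _
  rw [sub_zero, one_div] at h1
  refine h1.congr' ?_
  filter_upwards [eventually_ge_atTop 1] with T hT
  rw [stripBlim_eq_escape hT, div_eq_iff hc.ne']
  ring

/-! ### `Σ_T B_T = +∞`, unconditionally (Kesten's side of the renewal structure) -/

/-- **The critical bridge partition functions are not summable**: `Σ_{T < N} B_{T+1} ≥ m · Σ_{T < N} 1/(T+1) → +∞`
("`Z(x_c) ≥ Σ_T B_T^{x_c} = +∞`", now with no hypothesis: the harmonic lower bound is `stripBlim_ge_div`).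
This is the input of Kesten's relation `Σ_k f_k(x_c) = 1` for irreducible bridges.
[cite: DuminilCopinSmirnov2012, §3 (proof of Theorem 1, "Z(x_c) ≥ Σ_T B_T = +∞")] -/
theorem tendsto_sum_stripBlim_atTop :
    Tendsto (fun N : ℕ => ∑ T ∈ Finset.range N, stripBlim (T + 1)) atTop atTop := by
  set m := min (stripBlim 1) (Real.cos (3 * Real.pi / 8) * hexCriticalFugacity⁻¹)⁻¹ with hm
  have hmpos : 0 < m := stripBlim_ge_div_pos
  have hdiv := Real.tendsto_sum_range_one_div_nat_succ_atTop.const_mul_atTop hmpos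
  refine tendsto_atTop_mono (fun N => ?_) hdiv
  rw [Finset.mul_sum]
  refine Finset.sum_le_sum fun T _ => ?_
  rw [mul_one_div]
  exact stripBlim_ge_div T

end Literature.Probability.RandomPlanarGeometry.SAW
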